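import Summits.BirchSwinnertonDyer.BirchSwinnertonDyer.Theorems.GenusKolyvaginAtTwoEquivariantKolyvaginExactAtTwoTwistInfRes
import Summits.BirchSwinnertonDyer.BirchSwinnertonDyer.Theorems.GenusKolyvaginAtTwoEquivariantKolyvaginExactAtTwoQuadInfRes
import Literature.NumberTheory.EllipticCurves.BSDSelmerParityDokchitserBaseChangeProofs
import Literature.NumberTheory.EllipticCurves.TwoTorsionOddDegreeBaseChangeProofs
import HarnessLib

/-!
# Route `GenusKolyvaginAtTwo`, LINE 6, KEY crux Q3 `EquivariantKolyvaginExactAtTwo`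
# (stmt-BirchSwinnertonDyer-24882): THE TWIST SIDE OF INFLATION–RESTRICTION FOR `E/ℚ` —
# `H¹(ℚ, E^{(c)}[p^∞]) ≅ H¹(K, E[p^∞])^{τ = −1}` when `E(K)[p] = 0`; both eigen parts over `ℚ`
# on the habitat (PROVED)

Helper (seat `bsd-line-gk2-p3` g10, cell `bsd-f1-sign2`; `--supports` the item, closes nothing):
stub S1(−) of the eigen/`ℚ_ℓ` architecture for Q3 (memo Q3-ARCH v2, evidence #6 on the item), the
companion of g9's `…EquivariantKolyvaginExactAtTwoQuadInfRes` (S1(+), subgroup model) and of the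
generic file `…EquivariantKolyvaginExactAtTwoTwistInfRes` (this seat).

For `E = W/ℚ`, a quadratic field `K = ℚ(θ)`, `θ² = c` (`σ₀ : θ ↦ −θ`, `sigmaQ`), a prime `p`, and
the hypothesis `E(K)[p] = 0` (`∀ P ∈ E(K), p • P = 0 → P = 0`), in the INTRINSIC currency of the
tree (`galH1Primary X p = H¹(ℚ, X[p^∞])`, `galH1Primary (W.baseChange K) p = H¹(K, E[p^∞])`,
restriction `resPrimary X K p`, the twist isomorphism `hPsiK : H¹(K, E^{(c)}[p^∞]) ≃ H¹(K, E[p^∞])`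
over `K`, and the action `τ_* = (isLiftOfAut_liftAut σ₀).conjH1Primary W p` of the chosen lift of
`σ₀`, as in `BSDSelmerParityDokchitserBaseChangeProofs`):

* §2 `resPrimary_injective_and_range_eq_fixed` — **`res : H¹(ℚ, E[p^∞]) ↪ H¹(K, E[p^∞])` is
  injective with image `{y : τ_* y = y}`** (g9's S1(+) moved to the intrinsic model through
  `modelIso`, `modelIso_resPrimary`, `modelIso_conjH1Primary`);
  `resPrimary_twist_injective_and_range_eq_antifixed` — **S1(−): `hPsiK ∘ res :
  H¹(ℚ, E^{(c)}[p^∞]) ↪ H¹(K, E[p^∞])` is injective with image `{y : τ_* y = −y}`**, the sign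
  being the anti-equivariance of the twist isomorphism at `τ` (`psiQ_smul_liftToAbsGal`,
  `h1Equiv_psiQ_modelIso`); `exists_resPrimary_add_twist_eq_two_nsmul` (`y + τy` comes from `E`,
  `y − τy` from `E^{(c)}`, `2y` from both) and `two_nsmul_eq_zero_of_resPrimary_add_twist_eq_zero`
  (`res η + hPsiK res η' = 0 ⟹ 2η = 0 = 2η'`): the SHARP `±` descent on all of `H¹` (exponent `1`
  twice; the tree's Selmer-level `nsmul_eq_zero_of_comparisonMap_eq_zero` /
  `nsmul_mem_range_comparisonMap` have `8`).
* §3 `eigen_description_two_of_hasSurjectiveModNGaloisRep_two`, `eigen_description_two_of_habitat`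
  — at `p = 2` on the habitat of Q3 (`ρ̄_{E,2}` onto, equivalently the items' clause
  `∀ n > 0, HasSurjectiveModNGaloisRep (2^n)` at `n = 1`; `K` quadratic / `IsImaginaryQuadratic`)
  the hypothesis `E(K)[2] = 0` is the tree's
  `forall_two_nsmul_baseChange_of_hasSurjectiveModNGaloisRep_two_of_finrank_eq_two` (a cubic with no
  rational root has none over a quadratic field), so (1)–(4) hold UNCONDITIONALLY: the `τ = ±1`
  eigen subgroups of `H¹(K, E[2^∞])` ARE `H¹(ℚ, E[2^∞])` and `H¹(ℚ, E^K[2^∞])`, jointly of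
  exponent-`2` cokernel, meeting in the `τ`-fixed `2`-torsion. This is the frame in which McCallum
  §5 is to be run over `ℚ` on each eigen part with `ℚ_ℓ`-local dualities (Q3-ARCH v2 §4–§6; the
  residual global invariant is `Ĥ⁰(Gal(K/ℚ), ·)`, g9's `…Descent` §8).

Everything is PROVED from tree theorems (no named fact, no definition, no `sorry`, standard axioms).
BSD is not proved by any of this.

References: [GrossLMS1991] §5 (5.1); [McCallumLMS1991] §3, §5; [Dokchitser2013ParityNotes] §4;
[DokchitserDokchitserAnnals2010] Lemma 4.14; [SerreGaloisCohomology1997] I §2.6 (b);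
[DokchitserDokchitserMathZ2012] Theorem (1) (`ρ̄_{E,2}` onto ⟹ no rational `2`-torsion).
-/

set_option autoImplicit false
set_option linter.dupNamespace false -- tree convention: `Summit.BirchSwinnertonDyer.BirchSwinnertonDyer.Theorems` (summit = sub-problem)

noncomputable section

open scoped Classical

namespace Summit.BirchSwinnertonDyer.BirchSwinnertonDyer.Theorems.GenusExact.QuadInfResTwist

open WeierstrassCurve Literature.NumberTheory.EllipticCurves
open Summit.BirchSwinnertonDyer.BirchSwinnertonDyer.Theorems.GenusExact.TwistInfRes

/-! ## §2 Elliptic curves: `E/ℚ`, `K = ℚ(θ)`, `θ² = c`, a prime `p`, `E(K)[p] = 0` -/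

section Elliptic

variable (W : WeierstrassCurve ℚ) (K : Type) [Field K] [NumberField K] (h2 : Module.finrank ℚ K = 2)
  {θ : K} {c : ℚ} (hθ : θ ∉ Set.range (algebraMap ℚ K)) (hc : θ ^ 2 = algebraMap ℚ K c) (p : ℕ)

/-- `modelIso ∘ res = res_{Γ_ℚ → galRange K}` (the tree's `modelIso_resPrimary`, with the right-hand
side spelled `resSubgroupH1`). [cite: SerreGaloisCohomology1997, I §2.4] -/
theorem modelIso_resPrimary_eq (X : WeierstrassCurve ℚ) (x : galH1Primary X p) :
    modelIso K X p (resPrimary X K p x) =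
      resSubgroupH1 (galRange (K := ℚ) K) (geomPrimaryTorsion X p) x := by
  rw [modelIso_resPrimary]
  rfl

include h2 in
/-- **`E(K)[p] = 0 ⟹ res : H¹(ℚ, E[p^∞]) ↪ H¹(K, E[p^∞])` is injective and its image is the
`τ`-INVARIANT subgroup** — the INTRINSIC form (`galH1Primary`, `resPrimary`, the action
`conjH1Primary` of the chosen lift of the non-trivial `σ₀ ∈ Gal(K/ℚ)`) of g9's subgroup-model
theorem `QuadInfRes.infRes_quadratic_of_noTorsion`, for `K = ℚ(θ)`, `θ² = c`, any prime `p`: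
**`H¹(ℚ, E[p^∞]) = H¹(K, E[p^∞])^{τ = +1}`** (stub S1(+) by name in the currency of `Sel_{p^∞}`).
[cite: SerreGaloisCohomology1997, I §2.6 (b)] [cite: GrossLMS1991, §5 (5.1)] -/
theorem resPrimary_injective_and_range_eq_fixed
    (hL : ∀ P : (W.baseChange K).toAffine.Point, p • P = 0 → P = 0) :
    Function.Injective (resPrimary W K p) ∧
      ∀ y : galH1Primary (W.baseChange K) p,
        y ∈ (resPrimary W K p).range ↔
          (isLiftOfAut_liftAut (sigmaQ K h2 hθ hc)).conjH1Primary W p y = y := by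
  haveI : IsGalois ℚ K := isGalois_of_finrank_eq_two K h2
  haveI := normal_galRange K h2 (sigmaQ_ne_one K h2 hθ hc)
  have hfix := QuadInfRes.fixedPoints_galRange_eq_bot_of_noTorsion K W p hL
  have hinj : Function.Injective (resSubgroupH1 (galRange (K := ℚ) K) (geomPrimaryTorsion W p)) :=
    resSubgroupH1_injective_of_fixedPoints_eq_bot _ (continuous_smul_geomPrimaryTorsion W p) hfix
  refine ⟨fun x x' h ↦ hinj ?_, fun y ↦ ?_⟩
  · rw [← modelIso_resPrimary_eq K p W, ← modelIso_resPrimary_eq K p W, h]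
  · rw [← (modelIso K W p).injective.eq_iff, modelIso_conjH1Primary K W p (sigmaQ K h2 hθ hc) h2
      (sigmaQ_ne_one K h2 hθ hc), ← mem_range_resSubgroupH1_iff_conjH1_eq (isOpen_galRange K)
      (xor_galRange K h2 (sigmaQ_ne_one K h2 hθ hc)) (continuous_smul_geomPrimaryTorsion W p) hfix]
    constructor
    · rintro ⟨x, rfl⟩
      exact ⟨x, (modelIso_resPrimary_eq K p W x).symm⟩
    · rintro ⟨x, hx⟩
      exact ⟨x, (modelIso K W p).injective (by rw [modelIso_resPrimary_eq, hx])⟩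

include h2 in
/-- **THE TWIST SIDE, INTRINSIC FORM: `E(K)[p] = 0 ⟹ H¹(ℚ, E^{(c)}[p^∞]) ≅ H¹(K, E[p^∞])^{τ = −1}`.**
For `E/ℚ`, `K = ℚ(θ)`, `θ² = c`, a prime `p`, and no `K`-rational `p`-torsion on `E`: the map
`H¹(ℚ, E^{(c)}[p^∞]) → H¹(K, E^{(c)}[p^∞]) ≅ H¹(K, E[p^∞])` — restriction, then the tree's twist
isomorphism `hPsiK` over `K` (`E^{(c)} ≅ E` over `K`) — is INJECTIVE, and its image is EXACTLY the
subgroup of classes `y` with `τ_* y = −y` (action `conjH1Primary` of the chosen lift of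
`σ₀ : θ ↦ −θ`). The sign comes from the anti-equivariance of the twist isomorphism at `τ`
(`psiQ_smul_liftToAbsGal`: "`E_α ≅ E` over `K(√α)` with the Galois action twisted by the
quadratic character"). Reading for Q3 (`p = 2`, `K` the Heegner field, `E(K)[2] = 0` on the
habitat): the `τ`-ANTI-invariant part of `H¹(K, E[2^∞])` — where Kolyvagin's classes of sign
`ε_n = −1` live — IS the `ℚ`-cohomology of the twin `E^K`, so McCallum's argument on that eigen
part runs over `ℚ` with `ℚ_ℓ`-local dualities (memo Q3-ARCH v2 §4, stub S1(−)).
[cite: Dokchitser2013ParityNotes, §4, proof of the Theorem "[Squarity, NekIV, Kurast]"]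
[cite: SerreGaloisCohomology1997, I §2.6 (b)] [cite: GrossLMS1991, §5 (5.1)] -/
theorem resPrimary_twist_injective_and_range_eq_antifixed
    (hL : ∀ P : (W.baseChange K).toAffine.Point, p • P = 0 → P = 0) :
    Function.Injective (resPrimary (W.quadraticTwist c) K p) ∧
      ∀ y : galH1Primary (W.baseChange K) p,
        (∃ η' : galH1Primary (W.quadraticTwist c) p,
            hPsiK W K hθ hc p (resPrimary (W.quadraticTwist c) K p η') = y) ↔
          (isLiftOfAut_liftAut (sigmaQ K h2 hθ hc)).conjH1Primary W p y = -y := by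
  haveI : IsGalois ℚ K := isGalois_of_finrank_eq_two K h2
  haveI := normal_galRange K h2 (sigmaQ_ne_one K h2 hθ hc)
  have hfix := QuadInfRes.fixedPoints_galRange_eq_bot_of_noTorsion K W p hL
  have hfix' : FixedPoints.addSubgroup (galRange (K := ℚ) K)
      (geomPrimaryTorsion (W.quadraticTwist c) p) = ⊥ :=
    fixedPoints_eq_bot_of_equivariant_equiv (psiQ W K hθ hc p) (psiQ_smul W K hθ hc p) hfix
  have hinj : Function.Injective (resSubgroupH1 (galRange (K := ℚ) K)
      (geomPrimaryTorsion (W.quadraticTwist c) p)) :=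
    resSubgroupH1_injective_of_fixedPoints_eq_bot _
      (continuous_smul_geomPrimaryTorsion (W.quadraticTwist c) p) hfix'
  -- the key square: `modelIso (hPsiK (res' η')) = ψ_* (res_{galRange K} η')`
  have hsq : ∀ η' : galH1Primary (W.quadraticTwist c) p,
      modelIso K W p (hPsiK W K hθ hc p (resPrimary (W.quadraticTwist c) K p η')) =
        h1Equiv (psiQ W K hθ hc p) (psiQ_smul W K hθ hc p)
          (resSubgroupH1 (galRange (K := ℚ) K) (geomPrimaryTorsion (W.quadraticTwist c) p) η') :=
    fun η' ↦ by rw [← h1Equiv_psiQ_modelIso, modelIso_resPrimary_eq]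
  refine ⟨fun x x' h ↦ hinj ?_, fun y ↦ ?_⟩
  · rw [← modelIso_resPrimary_eq K p (W.quadraticTwist c),
      ← modelIso_resPrimary_eq K p (W.quadraticTwist c), h]
  · rw [← (modelIso K W p).injective.eq_iff, modelIso_conjH1Primary K W p (sigmaQ K h2 hθ hc) h2
      (sigmaQ_ne_one K h2 hθ hc), map_neg, ← exists_h1Equiv_resSubgroupH1_eq_iff (isOpen_galRange K)
      (xor_galRange K h2 (sigmaQ_ne_one K h2 hθ hc))
      (continuous_smul_geomPrimaryTorsion (W.quadraticTwist c) p) (psiQ W K hθ hc p)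
      (psiQ_smul W K hθ hc p) (psiQ_smul_liftToAbsGal W K h2 hθ hc p) hfix]
    constructor
    · rintro ⟨η', rfl⟩
      exact ⟨η', (hsq η').symm⟩
    · rintro ⟨η', hη'⟩
      exact ⟨η', (modelIso K W p).injective (by rw [hsq, hη'])⟩

include h2 hθ hc in
/-- **The two eigen images exhaust `H¹(K, E[p^∞])` up to the exponent `2`, SHARPLY**: with
`E(K)[p] = 0`, for every `y ∈ H¹(K, E[p^∞])` the class `y + τ_* y` is restricted from
`H¹(ℚ, E[p^∞])` and `y − τ_* y` from `H¹(ℚ, E^{(c)}[p^∞])` (through `hPsiK`); hence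
`2y ∈ res H¹(ℚ, E[p^∞]) + hPsiK res H¹(ℚ, E^{(c)}[p^∞])`. (The tree's Selmer-level statement
`nsmul_mem_range_comparisonMap` has exponent `8`.)
[cite: DokchitserDokchitserAnnals2010, Lemma 4.14 (proof)] -/
theorem exists_resPrimary_add_twist_eq_two_nsmul
    (hL : ∀ P : (W.baseChange K).toAffine.Point, p • P = 0 → P = 0)
    (y : galH1Primary (W.baseChange K) p) :
    (∃ η : galH1Primary W p, resPrimary W K p η =
        y + (isLiftOfAut_liftAut (sigmaQ K h2 hθ hc)).conjH1Primary W p y) ∧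
      (∃ η' : galH1Primary (W.quadraticTwist c) p,
        hPsiK W K hθ hc p (resPrimary (W.quadraticTwist c) K p η') =
          y - (isLiftOfAut_liftAut (sigmaQ K h2 hθ hc)).conjH1Primary W p y) ∧
      ∃ (η : galH1Primary W p) (η' : galH1Primary (W.quadraticTwist c) p),
        resPrimary W K p η + hPsiK W K hθ hc p (resPrimary (W.quadraticTwist c) K p η') = 2 • y := by
  haveI : IsGalois ℚ K := isGalois_of_finrank_eq_two K h2
  haveI := normal_galRange K h2 (sigmaQ_ne_one K h2 hθ hc)
  set τ := (isLiftOfAut_liftAut (sigmaQ K h2 hθ hc)).conjH1Primary W p with hτ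
  -- `τ_*` is an involution (read in the subgroup model)
  have hc2 := mul_self_mem_of_xor (xor_galRange K h2 (sigmaQ_ne_one K h2 hθ hc))
  have hinv : τ (τ y) = y := by
    apply (modelIso K W p).injective
    rw [hτ, modelIso_conjH1Primary K W p (sigmaQ K h2 hθ hc) h2 (sigmaQ_ne_one K h2 hθ hc),
      modelIso_conjH1Primary K W p (sigmaQ K h2 hθ hc) h2 (sigmaQ_ne_one K h2 hθ hc),
      conjH1_conjH1_of_mul_self_mem hc2]
  have hplus : ∃ η : galH1Primary W p, resPrimary W K p η = y + τ y := by
    have hmem : y + τ y ∈ (resPrimary W K p).range := by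
      rw [(resPrimary_injective_and_range_eq_fixed W K h2 hθ hc p hL).2, map_add, hinv, add_comm]
    exact hmem
  have hminus : ∃ η' : galH1Primary (W.quadraticTwist c) p,
      hPsiK W K hθ hc p (resPrimary (W.quadraticTwist c) K p η') = y - τ y := by
    rw [(resPrimary_twist_injective_and_range_eq_antifixed W K h2 hθ hc p hL).2, map_sub, hinv,
      neg_sub]
  obtain ⟨η, hη⟩ := hplus
  obtain ⟨η', hη'⟩ := hminus
  exact ⟨⟨η, hη⟩, ⟨η', hη'⟩, η, η', by rw [hη, hη', two_nsmul]; abel⟩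

include h2 in
/-- **SHARP kernel over `ℚ`**: with `E(K)[p] = 0`, if `res η + hPsiK (res η') = 0` in
`H¹(K, E[p^∞])` for `η ∈ H¹(ℚ, E[p^∞])`, `η' ∈ H¹(ℚ, E^{(c)}[p^∞])`, then `2η = 0` and `2η' = 0`
(the tree's Selmer-level `nsmul_eq_zero_of_comparisonMap_eq_zero` has exponent `8`).
[cite: DokchitserDokchitserAnnals2010, Lemma 4.14 (proof)] -/
theorem two_nsmul_eq_zero_of_resPrimary_add_twist_eq_zero
    (hL : ∀ P : (W.baseChange K).toAffine.Point, p • P = 0 → P = 0)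
    (η : galH1Primary W p) (η' : galH1Primary (W.quadraticTwist c) p)
    (h0 : resPrimary W K p η + hPsiK W K hθ hc p (resPrimary (W.quadraticTwist c) K p η') = 0) :
    2 • η = 0 ∧ 2 • η' = 0 := by
  haveI : IsGalois ℚ K := isGalois_of_finrank_eq_two K h2
  haveI := normal_galRange K h2 (sigmaQ_ne_one K h2 hθ hc)
  have hfix := QuadInfRes.fixedPoints_galRange_eq_bot_of_noTorsion K W p hL
  apply two_nsmul_eq_zero_of_add_eq_zero (isOpen_galRange K)
    (xor_galRange K h2 (sigmaQ_ne_one K h2 hθ hc)) (continuous_smul_geomPrimaryTorsion W p)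
    (continuous_smul_geomPrimaryTorsion (W.quadraticTwist c) p) (psiQ W K hθ hc p)
    (psiQ_smul W K hθ hc p) (psiQ_smul_liftToAbsGal W K h2 hθ hc p) hfix η η'
  have h := congrArg (modelIso K W p) h0
  rw [map_add, map_zero, ← h1Equiv_psiQ_modelIso, modelIso_resPrimary_eq,
    modelIso_resPrimary_eq] at h
  exact h

end Elliptic

/-! ## §3 The habitat of Q3: `p = 2`, `ρ̄_{E,2}` onto — both eigen statements unconditionally -/

section Habitat

variable (W : WeierstrassCurve ℚ) [W.IsElliptic] (K : Type) [Field K] [NumberField K]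
  (h2 : Module.finrank ℚ K = 2) {θ : K} {c : ℚ} (hθ : θ ∉ Set.range (algebraMap ℚ K))
  (hc : θ ^ 2 = algebraMap ℚ K c)

include h2 in
/-- **The `ℚ`-eigen description of `H¹(K, E[2^∞])` on the habitat of Q3.** For `E/ℚ` with
`ρ̄_{E,2}` onto and ANY quadratic field `K = ℚ(θ)`, `θ² = c` (so `E(K)[2] = 0`: a cubic without a
rational root has no root in a quadratic field — the tree's
`forall_two_nsmul_baseChange_of_hasSurjectiveModNGaloisRep_two_of_finrank_eq_two`, not re-proved here),
with `τ_*` the action of the lift of `σ₀ : θ ↦ −θ` on `H¹(K, E[2^∞])`: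
(1) `res : H¹(ℚ, E[2^∞]) → H¹(K, E[2^∞])` is injective with image `{y : τ_* y = y}`;
(2) `hPsiK ∘ res : H¹(ℚ, E^{(c)}[2^∞]) → H¹(K, E[2^∞])` is injective with image `{y : τ_* y = −y}`;
(3) `2 · H¹(K, E[2^∞]) ⊆ res H¹(ℚ, E[2^∞]) + hPsiK res H¹(ℚ, E^{(c)}[2^∞])`;
(4) `res η + hPsiK (res η') = 0 ⟹ 2η = 0 ∧ 2η' = 0`.
So the `±1`-eigen subgroups of `τ` on `H¹(K, E[2^∞])` ARE `H¹(ℚ, E[2^∞])` and `H¹(ℚ, E^K[2^∞])`,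
they generate a subgroup of exponent-`2` cokernel and meet in the `τ`-fixed `2`-torsion — the
frame in which Q3-ARCH v2 runs McCallum §5 over `ℚ` (stubs S1(±)); the one residual global `2`-adic
invariant of the descent is `Ĥ⁰(Gal(K/ℚ), ·)` (g9's `…Descent` §8). BSD is not proved by this.
[cite: GrossLMS1991, §5 (5.1)] [cite: Dokchitser2013ParityNotes, §4, proof of the Theorem "[Squarity, NekIV, Kurast]"]
[cite: DokchitserDokchitserMathZ2012, Theorem (1)] -/
theorem eigen_description_two_of_hasSurjectiveModNGaloisRep_two
    (hs : W.HasSurjectiveModNGaloisRep 2) :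
    (Function.Injective (resPrimary W K 2) ∧
      ∀ y : galH1Primary (W.baseChange K) 2,
        y ∈ (resPrimary W K 2).range ↔
          (isLiftOfAut_liftAut (sigmaQ K h2 hθ hc)).conjH1Primary W 2 y = y) ∧
    (Function.Injective (resPrimary (W.quadraticTwist c) K 2) ∧
      ∀ y : galH1Primary (W.baseChange K) 2,
        (∃ η' : galH1Primary (W.quadraticTwist c) 2,
            hPsiK W K hθ hc 2 (resPrimary (W.quadraticTwist c) K 2 η') = y) ↔
          (isLiftOfAut_liftAut (sigmaQ K h2 hθ hc)).conjH1Primary W 2 y = -y) ∧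
    (∀ y : galH1Primary (W.baseChange K) 2,
      ∃ (η : galH1Primary W 2) (η' : galH1Primary (W.quadraticTwist c) 2),
        resPrimary W K 2 η + hPsiK W K hθ hc 2 (resPrimary (W.quadraticTwist c) K 2 η') = 2 • y) ∧
    (∀ (η : galH1Primary W 2) (η' : galH1Primary (W.quadraticTwist c) 2),
      resPrimary W K 2 η + hPsiK W K hθ hc 2 (resPrimary (W.quadraticTwist c) K 2 η') = 0 →
        2 • η = 0 ∧ 2 • η' = 0) := by
  have hL : ∀ P : (W.baseChange K).toAffine.Point, 2 • P = 0 → P = 0 :=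
    forall_two_nsmul_baseChange_of_hasSurjectiveModNGaloisRep_two_of_finrank_eq_two W hs K h2
  exact ⟨resPrimary_injective_and_range_eq_fixed W K h2 hθ hc 2 hL,
    resPrimary_twist_injective_and_range_eq_antifixed W K h2 hθ hc 2 hL,
    fun y ↦ (exists_resPrimary_add_twist_eq_two_nsmul W K h2 hθ hc 2 hL y).2.2,
    fun η η' h0 ↦ two_nsmul_eq_zero_of_resPrimary_add_twist_eq_zero W K h2 hθ hc 2 hL η η' h0⟩

/-- **The same in the items' binder currency**: the habitat clause
`∀ n : ℕ, 0 < n → W.HasSurjectiveModNGaloisRep ((2 : ℤ) ^ n)` of crux Q3 / 22137 (at `n = 1`) and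
an imaginary quadratic `K` (`IsImaginaryQuadratic K`, so `[K : ℚ] = 2`), written `K = ℚ(θ)`,
`θ² = c` (`Quadratic.exists_sq_eq_algebraMap` produces such `θ, c`; `d_K = c q²`, so
`E^{(d_K)} ≅ E^{(c)}`, `NumberField.exists_discr_eq_mul_sq`). [cite: GrossLMS1991, §5 (5.1)] -/
theorem eigen_description_two_of_habitat
    (hρ : ∀ n : ℕ, 0 < n → W.HasSurjectiveModNGaloisRep ((2 : ℤ) ^ n))
    (hK : IsImaginaryQuadratic K) {θ : K} {c : ℚ} (hθ : θ ∉ Set.range (algebraMap ℚ K))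
    (hc : θ ^ 2 = algebraMap ℚ K c) :
    (Function.Injective (resPrimary W K 2) ∧
      ∀ y : galH1Primary (W.baseChange K) 2,
        y ∈ (resPrimary W K 2).range ↔
          (isLiftOfAut_liftAut (sigmaQ K hK.1 hθ hc)).conjH1Primary W 2 y = y) ∧
    (Function.Injective (resPrimary (W.quadraticTwist c) K 2) ∧
      ∀ y : galH1Primary (W.baseChange K) 2,
        (∃ η' : galH1Primary (W.quadraticTwist c) 2,
            hPsiK W K hθ hc 2 (resPrimary (W.quadraticTwist c) K 2 η') = y) ↔
          (isLiftOfAut_liftAut (sigmaQ K hK.1 hθ hc)).conjH1Primary W 2 y = -y) ∧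
    (∀ y : galH1Primary (W.baseChange K) 2,
      ∃ (η : galH1Primary W 2) (η' : galH1Primary (W.quadraticTwist c) 2),
        resPrimary W K 2 η + hPsiK W K hθ hc 2 (resPrimary (W.quadraticTwist c) K 2 η') = 2 • y) ∧
    (∀ (η : galH1Primary W 2) (η' : galH1Primary (W.quadraticTwist c) 2),
      resPrimary W K 2 η + hPsiK W K hθ hc 2 (resPrimary (W.quadraticTwist c) K 2 η') = 0 →
        2 • η = 0 ∧ 2 • η' = 0) := by
  have hs : W.HasSurjectiveModNGaloisRep 2 := by simpa using hρ 1 one_pos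
  exact eigen_description_two_of_hasSurjectiveModNGaloisRep_two W K hK.1 hθ hc hs

end Habitat

end Summit.BirchSwinnertonDyer.BirchSwinnertonDyer.Theorems.GenusExact.QuadInfResTwist

end
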